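import Summits.FinalStateConjecture.FinalStateConjecture.Theses.StarvedNecks
import Summits.FinalStateConjecture.FinalStateConjecture.Theses.SwallowTheDatum
import Literature.Geometry.Lorentzian.KerrDataProofs
import Literature.Geometry.Lorentzian.KerrSchildCoord

/-!
# Crux `HonestFixedRadiusSettling` (stmt-FinalStateConjecture-13550) — ideator 3, round 1 — Sketch

First lemmas of the crux idea cards (must elaborate; proofs only where pure logic).

Card `inherit-the-burial-exact-kerr-honesty`:
* `KerrShieldedSettlesHonestly` — the G-side analogue of `SwallowTheDatum.KerrShieldedSettles`:
  a Kerr-shielded admissible datum satisfies, in every MGHD, the ∀-MGHD clause of the HONEST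
  C⁴ fixed-radius property whose Christodoulou-genericity is the crux (HonestCore ∧ HonestFar copied
  verbatim from the route decl).
* `UniversalHonestWitnessFamily` — the transfer statement C⁺.
* `honestWitnessFamily_of_cruxes`, `honestFixedRadiusSettling_of_witnessFamily`,
  `honestFixedRadiusSettling_of_burial` — pure logic, sorry-free: the crux follows from
  `ParametricKerrBurial` (route SwallowTheDatum, item 10052), `KerrShieldedSettlesHonestly` (new) and
  `MGHDExists` (shared item 9937).
-/

set_option linter.dupNamespace false

namespace Summit.FinalStateConjecture.FinalStateConjecture.Cruxes.HonestFixedRadiusSettling.Sketch3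

open scoped Manifold ContDiff ENNReal Topology
open Filter Set Literature.Geometry.Lorentzian

/-- **First lemma (card inherit-the-burial-exact-kerr-honesty).** A Kerr-shielded admissible datum
(shielding block verbatim from `SwallowTheDatum.KerrShieldedSettles`: outside a compact set the datum
IS the hard-coded bent Kerr–Schild/Boyer–Lindquist slice of a sub-extremal Kerr entering the hole,
junction `r₋ < r₁ < r₊`) satisfies in EVERY maximal vacuum Cauchy development the ∀-MGHD clause of
the crux's property: complete `𝓘⁺` (sojourn form) and an `N = 1`, `C⁴` final-state decomposition of
`O = J⁺(ιX) ∩ I⁻(charted)` with `HonestCore ∧ HonestFar` at some `R₀` (the two let-bound predicates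
of `StarvedNecks.HonestFixedRadiusSettling`, verbatim). Intended proof: the disprover's bent charts
for `KerrShieldedSettles` (hole chart `(x⁰,x) ↦ (x⁰ + c₀ + T(r)χ((r−2R(x⁰))/R(x⁰)), x)`, flat chart
`(x⁰,x) ↦ (x⁰ + c₀ + T(r), x)` on `{r > √x⁰}`), `R₀ := 1000 M`, anchoring by stationary rotating
observers `∂_t* + Ω∂_φ*`, relative closedness from `O = {r > r₊, t* ≥ T(r)}`. -/
def KerrShieldedSettlesHonestly : Prop :=
  open Literature.Geometry.Lorentzian in open scoped ContDiff ENNReal in let Hc := ( fun (𝓢 : Spacetime.{0} 4) (O : Set 𝓢.carrier) (k : ℕ) (d : FinalStateDecomposition 𝓢 O k) (R₀ : ℝ) => let B := d.background; let t := fun i ↦ (B i).time; let r := fun i ↦ (B i).radius; let Ψ := d.chart; (∀ i, Kerr.IsSubextremal (d.mass i) (d.spin i) ∧ 100 * d.mass i ≤ R₀ ∧ 0 < ((d.motion i).1 : E4 ≃L[ℝ] E4) (E4.basisVector 0) 0) ∧ (∀ i (ϱ τ₂ : ℝ), R₀ ≤ ϱ → d.τ₀ < τ₂ → Ψ i ''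 {x | d.τ₀ < t i x.1 ∧ t i x.1 < τ₂ ∧ r i x.1 < ϱ} ⊆ 𝓢.metric.causalPast 𝓢.timeOrientation (Ψ i '' (B i).truncTimeSlab ϱ τ₂)) ∧ (∀ i (τ' : ℝ) (ϱ : ℝ → ℝ), Continuous ϱ → d.τ₀ < τ' → let A := Ψ i '' {x | τ' ≤ t i x.1 ∧ r i x.1 ≤ ϱ (t i x.1)}; closure A ∩ O ⊆ A) ∧ (∀ y : d.flatDomain, d.τ₀ < y.1 0 → 𝓢.timeOrientation.IsFutureDirected (mfderiv 𝓘(ℝ, E4) (𝓡 4) d.flatChart y (E4.basisVector 0))) ); let Hf := ( fun (𝓢 : Spacetime.{0} 4) (O : Set 𝓢.carrier) (k : ℕ) (d : FinalStateDecomposition 𝓢 O k) (R₀ : ℝ) => let B := d.background; let t := fun i ↦ (B i).time; let r := fun i ↦ (B i).radius; let Φ := d.flatChart; (∀ τ₂ : ℝ, d.τ₀ < τ₂ → Φ '' {y | d.τ₀ < y.1 0 ∧ y.1 0 < τ₂} ⊆ 𝓢.metric.causalPast 𝓢.timeOrientation (Φ '' (Minkowski.backgroundOn d.flatDomain).timeSlab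 τ₂)) ∧ (∀ τ' : ℝ, d.τ₀ < τ' → closure (Φ '' {y | τ' ≤ y.1 0 ∧ ∀ i, d.excision i (y.1 0) + 1 ≤ r i y.1}) ⊆ Φ '' {y | τ' ≤ y.1 0}) ∧ (∀ i, ∃ T : ℝ, supCkENorm (Subtype.val '' {x : (B i).domain | T ≤ t i x.1 ∧ R₀ ≤ r i x.1 ∧ ∀ j, j ≠ i → r i x.1 ≤ r j x.1}) 0 (𝓢.deviationExtend (B i) (d.chart i)) ≤ ENNReal.ofReal (1 / (10 * ‖(((d.motion i).1 : E4 ≃L[ℝ] E4) : E4 →L[ℝ] E4)‖ ^ 2))) ); ∀ [Literature.Geometry.Lorentzian.Kerr.Facts] (X : Type) [TopologicalSpace X] [ChartedSpace Literature.Geometry.Lorentzian.E3 X] [IsManifold (𝓡 3) ((⊤ : ℕ∞) : WithTop ℕ∞) X] [T2Space X] [SecondCountableTopology X] [ConnectedSpace X], ∀ D ∈ Literature.Geometry.Lorentzian.admissibleVacuumData X, (∃ (M a r₁ : ℝ) (hM : 0 ≤ M) (T : ℝ → ℝ) (φ : Literature.Geometry.Lorentzian.Kerr.slice a r₁ → X)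 (ψ : Literature.Geometry.Lorentzian.Kerr.slice a r₁ → Literature.Geometry.Lorentzian.Kerr.region a r₁) (ν : Literature.Geometry.Lorentzian.NormalField 𝓘(ℝ, Literature.Geometry.Lorentzian.E4) ψ), |a| < M ∧ Literature.Geometry.Lorentzian.Kerr.rMinus M a < r₁ ∧ r₁ < Literature.Geometry.Lorentzian.Kerr.rPlus M a ∧ T = (fun r : ℝ => Real.smoothTransition (r / (4 * M) - 1) * (((M) / Real.sqrt ((M) ^ 2 - (a) ^ 2)) * (Literature.Geometry.Lorentzian.Kerr.rPlus M a * Real.log (r - Literature.Geometry.Lorentzian.Kerr.rPlus M a) - Literature.Geometry.Lorentzian.Kerr.rMinus M a * Real.log (r - Literature.Geometry.Lorentzian.Kerr.rMinus M a)) - ((M) / Real.sqrt ((M) ^ 2 - (a) ^ 2)) * (Literature.Geometry.Lorentzian.Kerr.rPlus M a * Real.log ((4 * M) - Literature.Geometry.Lorentzian.Kerr.rPlus M a) - Literature.Geometry.Lorentzian.Kerr.rMinus M a * Real.log ((4 * M) - Literature.Geometry.Lorentzian.Kerr.rMinus M a)))) ∧ IsCompact (Set.range φ)ᶜ ∧ Topology.IsOpenEmbedding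 φ ∧ ContMDiff 𝓘(ℝ, Literature.Geometry.Lorentzian.E3) (𝓡 3) ((⊤ : ℕ∞) : WithTop ℕ∞) φ ∧ (∀ y : Literature.Geometry.Lorentzian.Kerr.slice a r₁, (ψ y : Literature.Geometry.Lorentzian.E4) = Literature.Geometry.Lorentzian.E4.ofTimeSpace (T (Literature.Geometry.Lorentzian.Kerr.radius a (Literature.Geometry.Lorentzian.E4.ofTimeSpace 0 (y : Literature.Geometry.Lorentzian.E3)))) (y : Literature.Geometry.Lorentzian.E3)) ∧ (Literature.Geometry.Lorentzian.Kerr.smoothMetric M a r₁).IsSpacelikeImmersion 𝓘(ℝ, Literature.Geometry.Lorentzian.E3) ψ ∧ (Literature.Geometry.Lorentzian.Kerr.smoothMetric M a r₁).IsFutureUnitNormal 𝓘(ℝ, Literature.Geometry.Lorentzian.E3) ((Literature.Geometry.Lorentzian.Kerr.timeOrientation M a r₁ hM).ofLE le_top) ψ ν ∧ (∀ y : Literature.Geometry.Lorentzian.Kerr.slice a r₁, Literature.Geometry.Lorentzian.pullbackBilin (I := 𝓡 3) (I' := 𝓘(ℝ, Literature.Geometry.Lorentzian.E3)) φ (D).h.inner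 y = Literature.Geometry.Lorentzian.pullbackBilin (I := 𝓘(ℝ, Literature.Geometry.Lorentzian.E4)) (I' := 𝓘(ℝ, Literature.Geometry.Lorentzian.E3)) ψ (Literature.Geometry.Lorentzian.Kerr.smoothMetric M a r₁).val y) ∧ (∀ [(Literature.Geometry.Lorentzian.Kerr.smoothMetric M a r₁).HasLeviCivita] (y : Literature.Geometry.Lorentzian.Kerr.slice a r₁), (Literature.Geometry.Lorentzian.pullbackBilin (I := 𝓡 3) (I' := 𝓘(ℝ, Literature.Geometry.Lorentzian.E3)) φ (D).k y).toLinearMap₁₂ = (Literature.Geometry.Lorentzian.Kerr.smoothMetric M a r₁).secondFundamentalForm 𝓘(ℝ, Literature.Geometry.Lorentzian.E3) ψ ν y)) → ∀ 𝒟 : VacuumCauchyDevelopment D, 𝒟.IsMaximal → HasCompleteNullInfinity 𝒟.toCauchyDevelopment ∧ ∃ (O : Set 𝒟.carrier) (d : FinalStateDecomposition 𝒟.toSpacetime O 4) (R₀ : ℝ), O = exteriorOf 𝒟.toCauchyDevelopment d.charted ∧ Hc 𝒟.toSpacetime O 4 d R₀ ∧ Hf 𝒟.toSpacetime O 4 d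 R₀

/-- The honest property `P_G` of one datum, as a predicate (same lets, same body as the crux). -/
def HonestProperty (X : Type) [TopologicalSpace X] [ChartedSpace E3 X] [IsManifold (𝓡 3) ∞ X]
    [T2Space X] [SecondCountableTopology X] [ConnectedSpace X] (D : InitialDataSet (𝓡 3) X) :
    Prop :=
  open Literature.Geometry.Lorentzian in open scoped ContDiff ENNReal in let Hc := ( fun (𝓢 : Spacetime.{0} 4) (O : Set 𝓢.carrier) (k : ℕ) (d : FinalStateDecomposition 𝓢 O k) (R₀ : ℝ) => let B := d.background; let t := fun i ↦ (B i).time; let r := fun i ↦ (B i).radius; let Ψ := d.chart; (∀ i, Kerr.IsSubextremal (d.mass i) (d.spin i) ∧ 100 * d.mass i ≤ R₀ ∧ 0 < ((d.motion i).1 : E4 ≃L[ℝ] E4) (E4.basisVector 0) 0) ∧ (∀ i (ϱ τ₂ : ℝ), R₀ ≤ ϱ → d.τ₀ < τ₂ → Ψ i '' {x | d.τ₀ < t i x.1 ∧ t i x.1 < τ₂ ∧ r i x.1 < ϱ} ⊆ 𝓢.metric.causalPast 𝓢.timeOrientation (Ψ i '' (B i).truncTimeSlab ϱ τ₂)) ∧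 (∀ i (τ' : ℝ) (ϱ : ℝ → ℝ), Continuous ϱ → d.τ₀ < τ' → let A := Ψ i '' {x | τ' ≤ t i x.1 ∧ r i x.1 ≤ ϱ (t i x.1)}; closure A ∩ O ⊆ A) ∧ (∀ y : d.flatDomain, d.τ₀ < y.1 0 → 𝓢.timeOrientation.IsFutureDirected (mfderiv 𝓘(ℝ, E4) (𝓡 4) d.flatChart y (E4.basisVector 0))) ); let Hf := ( fun (𝓢 : Spacetime.{0} 4) (O : Set 𝓢.carrier) (k : ℕ) (d : FinalStateDecomposition 𝓢 O k) (R₀ : ℝ) => let B := d.background; let t := fun i ↦ (B i).time; let r := fun i ↦ (B i).radius; let Φ := d.flatChart; (∀ τ₂ : ℝ, d.τ₀ < τ₂ → Φ '' {y | d.τ₀ < y.1 0 ∧ y.1 0 < τ₂} ⊆ 𝓢.metric.causalPast 𝓢.timeOrientation (Φ '' (Minkowski.backgroundOn d.flatDomain).timeSlab τ₂)) ∧ (∀ τ' : ℝ, d.τ₀ < τ' → closure (Φ '' {y | τ' ≤ y.1 0 ∧ ∀ i, d.excision i (y.1 0) + 1 ≤ r i y.1}) ⊆ Φ '' {y | τ'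 ≤ y.1 0}) ∧ (∀ i, ∃ T : ℝ, supCkENorm (Subtype.val '' {x : (B i).domain | T ≤ t i x.1 ∧ R₀ ≤ r i x.1 ∧ ∀ j, j ≠ i → r i x.1 ≤ r j x.1}) 0 (𝓢.deviationExtend (B i) (d.chart i)) ≤ ENNReal.ofReal (1 / (10 * ‖(((d.motion i).1 : E4 ≃L[ℝ] E4) : E4 →L[ℝ] E4)‖ ^ 2))) ); (∃ 𝒟 : VacuumCauchyDevelopment D, 𝒟.IsMaximal) ∧ ∀ 𝒟 : VacuumCauchyDevelopment D, 𝒟.IsMaximal → HasCompleteNullInfinity 𝒟.toCauchyDevelopment ∧ ∃ (O : Set 𝒟.carrier) (d : FinalStateDecomposition 𝒟.toSpacetime O 4) (R₀ : ℝ), O = exteriorOf 𝒟.toCauchyDevelopment d.charted ∧ Hc 𝒟.toSpacetime O 4 d R₀ ∧ Hf 𝒟.toSpacetime O 4 d R₀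

/-- **Transfer statement C⁺ (card inherit-the-burial-exact-kerr-honesty).** Through EVERY admissible
datum passes a jointly smooth injective admissible one-parameter family all of whose members `F c`,
`c ≠ 0`, satisfy the honest property `P_G`. Stronger than the crux (which asks it only at exceptional
data), easier because no member's own development is ever analysed. -/
def UniversalHonestWitnessFamily : Prop :=
  ∀ (X : Type) [TopologicalSpace X] [ChartedSpace E3 X] [IsManifold (𝓡 3) ∞ X] [T2Space X]
    [SecondCountableTopology X] [ConnectedSpace X], ∀ d ∈ admissibleVacuumData X,
    ∃ F : EuclideanSpace ℝ (Fin 1) → InitialDataSet (𝓡 3) X,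
      InitialDataSet.IsSmoothDataFamily 1 F ∧ F 0 = d ∧ Function.Injective F ∧
      (∀ c, F c ∈ admissibleVacuumData X) ∧ ∀ c ≠ 0, HonestProperty X (F c)

/-- C⁺ ⇒ crux: unfolding of `IsChristodoulouGeneric … 1 = HasCodimAtLeastIn 𝓓 {d ∈ 𝓓 | ¬P d} 1`. -/
theorem honestFixedRadiusSettling_of_witnessFamily (h : UniversalHonestWitnessFamily) :
    Theses.StarvedNecks.HonestFixedRadiusSettling := by
  unfold Theses.StarvedNecks.HonestFixedRadiusSettling
  intro Hc Hf X _ _ _ _ _ _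
  unfold InitialDataSet.IsChristodoulouGeneric InitialDataSet.HasCodimAtLeastIn
  intro d hd
  obtain ⟨F, hF, h0, hinj, hadm, hP⟩ := h X d hd.1
  refine ⟨F, hF, h0, hinj, hadm, fun c hc hmem ↦ hmem.2 ?_⟩
  have hPc := hP c hc
  unfold HonestProperty at hPc
  exact hPc

/-- The three inputs give C⁺ (pure logic, as `Theorems.SwallowTheDatum.targetGlue_proof`). -/
theorem honestWitnessFamily_of_cruxes
    (hB : Theses.SwallowTheDatum.ParametricKerrBurial)
    (hS : KerrShieldedSettlesHonestly)
    (hM : Theses.SwallowTheDatum.MGHDExists) :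
    UniversalHonestWitnessFamily := by
  intro X _ _ _ _ _ _ d hd
  haveI : Kerr.Facts :=
    ⟨Kerr.isConnected_region_holds, Kerr.contMDiff_bilin_holds, Kerr.contMDiff_timeVector_holds⟩
  obtain ⟨F, hF, h0, hinj, hadm, hshield⟩ := hB X d hd
  refine ⟨F, hF, h0, hinj, hadm, fun c hc ↦ ?_⟩
  have hSc := hS X (F c) (hadm c) (hshield c hc)
  unfold HonestProperty
  exact ⟨hM X (F c) (hadm c), fun 𝒟 h𝒟 ↦ hSc 𝒟 h𝒟⟩

/-- **The line**: `ParametricKerrBurial → KerrShieldedSettlesHonestly → MGHDExists → crux`. -/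
theorem honestFixedRadiusSettling_of_burial
    (hB : Theses.SwallowTheDatum.ParametricKerrBurial)
    (hS : KerrShieldedSettlesHonestly)
    (hM : Theses.SwallowTheDatum.MGHDExists) :
    Theses.StarvedNecks.HonestFixedRadiusSettling :=
  honestFixedRadiusSettling_of_witnessFamily (honestWitnessFamily_of_cruxes hB hS hM)

end Summit.FinalStateConjecture.FinalStateConjecture.Cruxes.HonestFixedRadiusSettling.Sketch3
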